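import Mathlib
import HarnessLib.Audit
import Summits.PneNP.PneNP.Theorems.PstarCrossCaseP
import Summits.PneNP.PneNP.Theorems.PstarCrossProductRow
import Summits.PneNP.PneNP.Theorems.PstarCrossProductAlgebra
import Summits.PneNP.PneNP.Theorems.PstarCrossUnitRank
import Summits.PneNP.PneNP.Theorems.PstarNorUnitMixed

/-!
# The blind free CROSS gate, regime P (node N2), a single UNIT chord: every private tree edge lies in its fundamental set (O2 / E1; prover-1 g23)

FRONTIER range-avoidance ladder, rung F-N3 (`stmt-PneNP-19007`), cell `pnp-ideate`; restricted-model proof complexity — nothing here bears on `P` versus `NP`.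

Regime P (`q := q_{(1,0)}`, polar form `polarDir (1,0)`), a real chord `e` that is a UNIT w.r.t. `q` (`PstarNorUnitExcCore.exc_unit_core`: `D e = {j₁, j₂}`,
`Q_{D e} = q + ν₁ν₂ + κ` with the linear parts of `ν₁, ν₂` supported on one literal `σ ∈ j₁` and one `τ ∈ j₂`, polar formula
`polarDir (1,0) (e_v, e_w) = [v ~ w in D e] + [{v,w} = {σ,τ}]`).  Then a private tree edge `π ∉ D e` is read by NEITHER constraint:

* the second: its row `u_e + (q + κ') = ν₁ν₂` is a product row with factors blind at `π` (`PstarCrossProductRow.untouched_of_product_row`);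
* hence `q` is blind at `π` (`q(x + e_v) = q(x)`: no linear read, and the polar formula pairs `v` with nothing);
* the first: `q_{(0,1)} + κ₁` vanishes on `Z(q)` (`PstarCrossCaseP.qDir01_of_q`) and `q` has rank four (`PstarCrossUnitRank.rank_four_of_unit_formula`), so by
  `PstarRankRigidityFour.classification` it is `0`, `q`, or (up to `q`) a product of affine functions — degenerate products are `0`
  (`PstarCrossProductAlgebra.affine_eq_zero_of_vanish`), non-degenerate ones are blind at `π` by the shift lemma (`shift_of_vanish`) — or `q` is in NOR
  form, impossible next to a unit (`PstarNorUnitMixed.false_of_nor_of_excUnit`).  In every case `q_{(0,1)}` has no linear term and no polar pair at `v`.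
* **`unit_privEdge_mem_D`** — so by TOUCH (`PstarCrossBudget.cross_touch`) every private tree edge lies in `D e = {j₁, j₂}`.
-/

set_option linter.dupNamespace false -- `Summit.PneNP.PneNP.…`: summit = sub-problem name (D-0017 single-conjunct layout)

open Finset Module Literature.Computability.Complexity
open Summit.PneNP.PneNP.Theorems.PstarTyped (Typed)
open Summit.PneNP.PneNP.Theorems.PstarSALevel (varSet BoundaryExpanding SimpleOverlap)
open Summit.PneNP.PneNP.Theorems.PstarCentreFree (vars_mem_varSet)
open Summit.PneNP.PneNP.Theorems.PstarGapLinearised (andPair)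
open Summit.PneNP.PneNP.Theorems.PstarChordEndgameTools (mem_andPair_iff)
open Summit.PneNP.PneNP.Theorems.PstarCubeIdeals (IsAffineFn IsQuadFn)
open Summit.PneNP.PneNP.Theorems.PstarQuadRank (rad)
open Summit.PneNP.PneNP.Theorems.PstarProductRank (qform polar)
open Summit.PneNP.PneNP.Theorems.PstarPathRank (AndAdj polar_basis and_ne)
open Summit.PneNP.PneNP.Theorems.PstarReadSumset (V2)
open Summit.PneNP.PneNP.Theorems.PstarRankRigidityTwo (affine_mul_polar symForm symForm_apply linPart linPart_apply)
open Summit.PneNP.PneNP.Theorems.PstarRankRigidityFour (classification)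
open Summit.PneNP.PneNP.Theorems.PstarForcing (polar_unique exists_ne_of_rank_four)
open Summit.PneNP.PneNP.Theorems.PstarChordSystem (ChordSystem)
open Summit.PneNP.PneNP.Theorems.PstarChordBridgeTools
open Summit.PneNP.PneNP.Theorems.PstarChordBridge
open Summit.PneNP.PneNP.Theorems.PstarChordBridgeForcing (freeMon freePolar gam sys_u_eq)
open Summit.PneNP.PneNP.Theorems.PstarChordBridgeBasis (qDir polarDir)
open Summit.PneNP.PneNP.Theorems.PstarChordBridgeCorner (qDir_add)
open Summit.PneNP.PneNP.Theorems.PstarGateCasePUnitsTouch (not_mem_C_of_qDir polarDir_single qDir_single_add_zero freeMon_avoid_of_polarDir_zero)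
open Summit.PneNP.PneNP.Theorems.PstarXCore (xverts)
open Summit.PneNP.PneNP.Theorems.PstarCrossData (CrossData)
open Summit.PneNP.PneNP.Theorems.PstarCrossSystem
open Summit.PneNP.PneNP.Theorems.PstarCrossCorner (PrivEdge)
open Summit.PneNP.PneNP.Theorems.PstarCrossBudget (cross_touch)
open Summit.PneNP.PneNP.Theorems.PstarCrossCaseP (qDir10_eq u_of_q qDir01_of_q exists_q_p)
open Summit.PneNP.PneNP.Theorems.PstarCrossProductRow (untouched_of_product_row)
open Summit.PneNP.PneNP.Theorems.PstarCrossProductAlgebra (affine_eq_zero_of_vanish isAffineFn_mul_of_degenerate shift_of_vanish)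
open Summit.PneNP.PneNP.Theorems.PstarCrossUnitRank (apply_single_eq_zero rank_four_of_unit_formula)
open Summit.PneNP.PneNP.Theorems.PstarNorUnitMixed (false_of_nor_of_excUnit)

namespace Summit.PneNP.PneNP.Theorems.PstarCrossCasePUnitBlind

variable {n m : ℕ}

section

variable (I : LocalMap 4 n m) {r : ℕ} {B : BridgeData n m} {e_p e_q g₀ : Fin m}

/-- An AND variable of a private tree edge outside `D e = {j₁, j₂}` is no variable of `j₁`, `j₂`; in particular it is neither literal of the unit. -/
theorem privEdge_off_unit (hD : CrossData I r B e_p e_q g₀) {e : Fin m} (he : e ∈ B.N) {j₁ j₂ : Fin m} (hDe : B.D e = {j₁, j₂})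
    {π : Fin m} (hπ : PrivEdge I B π) (hπD : π ∉ B.D e) {s : Fin 4} (hs : s = 2 ∨ s = 3) :
    (∀ j ∈ B.D e, I.vars π s ∉ varSet I j) ∧ ∀ {c : Fin n}, (c ∈ andPair I j₁ ∨ c ∈ andPair I j₂) → I.vars π s ≠ c := by
  have hDJ : B.D e ⊆ B.J₀ := (hD.wf.hD e he).trans sdiff_subset
  have key : ∀ j ∈ B.D e, I.vars π s ∉ varSet I j := fun j hj => by
    have h := hπ.2 j (hDJ hj) (fun h => hπD (h ▸ hj))
    rcases hs with rfl | rfl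
    · exact h.1
    · exact h.2
  refine ⟨key, fun {c} hc hce => ?_⟩
  have hj₁ : j₁ ∈ B.D e := by rw [hDe]; exact mem_insert_self _ _
  have hj₂ : j₂ ∈ B.D e := by rw [hDe]; exact mem_insert_of_mem (mem_singleton_self _)
  rw [hce] at key
  rcases hc with hc | hc
  · rcases (mem_andPair_iff I j₁ c).1 hc with h | h
    · exact key j₁ hj₁ (h ▸ vars_mem_varSet I j₁ 2)
    · exact key j₁ hj₁ (h ▸ vars_mem_varSet I j₁ 3)
  · rcases (mem_andPair_iff I j₂ c).1 hc with h | h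
    · exact key j₂ hj₂ (h ▸ vars_mem_varSet I j₂ 2)
    · exact key j₂ hj₂ (h ▸ vars_mem_varSet I j₂ 3)

/-- **A single unit: every private tree edge lies in `D e`.**  See the module docstring. -/
theorem unit_privEdge_mem_D (hI : I.IsPure xorAndPred) (hT : Typed I) (hS : SimpleOverlap I)
    (hD : CrossData I r B e_p e_q g₀) (hSR : ((sys I B).vsys e_p e_q).SingleRead) {e : Fin m} (he : e ∈ (B.N.erase e_q).erase e_p)
    {ν₁ ν₂ : (Fin n → ZMod 2) → ZMod 2} (hν₁ : IsAffineFn ν₁) (hν₂ : IsAffineFn ν₂) {κ : ZMod 2}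
    (hEXC : ∀ x, qform (B.D e) (fun j => I.vars j 2) (fun j => I.vars j 3) x = qDir I B (1, 0) x + ν₁ x * ν₂ x + κ)
    {j₁ j₂ : Fin m} {σ τ : Fin n} (hDe : B.D e = {j₁, j₂}) (hdisj : Disjoint (andPair I j₁) (andPair I j₂))
    (hσ : σ ∈ andPair I j₁) (hτ : τ ∈ andPair I j₂)
    (hsupp : ∀ v : Fin n, (ν₁ (Pi.single v 1) ≠ ν₁ 0 ∨ ν₂ (Pi.single v 1) ≠ ν₂ 0) ↔ (v = σ ∨ v = τ))
    (hpol : ∀ v w : Fin n, polarDir I B (1, 0) (Pi.single v 1) (Pi.single w 1) =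
      (if AndAdj I (B.D e) v w then 1 else 0) + (if (v = σ ∧ w = τ) ∨ (v = τ ∧ w = σ) then 1 else 0))
    {π : Fin m} (hπ : PrivEdge I B π) : π ∈ B.D e := by
  classical
  by_contra hπD
  have hW := hD.wf
  have heq : e ∈ B.N.erase e_q := mem_of_mem_erase he
  have hne : e ≠ e_p := ne_of_mem_erase he
  have heN : e ∈ B.N := mem_of_mem_erase heq
  have hd₁ : Disjoint B.G₁ B.J₀ := Finset.disjoint_of_subset_left (subset_insert g₀ B.G₁) hD.disj₁
  have hGfree : ∀ G : Finset (Fin m), (∀ v ∈ privs I B.N, ∀ g ∈ G, I.vars g 2 ≠ v ∧ I.vars g 3 ≠ v) →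
      ∀ g ∈ G, ¬ (I.vars g 2 ∈ privs I B.N ∨ I.vars g 3 ∈ privs I B.N) := by
    intro G h g hg hor
    rcases hor with h2 | h3
    · exact (h _ h2 g hg).1 rfl
    · exact (h _ h3 g hg).2 rfl
  have hGf₁ := hGfree B.G₁ fun v hv => (hD.hun v hv).1
  have hGf₂ := hGfree B.G₂ fun v hv => (hD.hun v hv).2
  have hlin₂ : ∀ (π : Fin m) (s : Fin 4), π ∈ B.J₀ \ B.N → 2 ≤ s.val →
      qDir I B (1, 0) (Pi.single (I.vars π s) 1) = qDir I B (1, 0) 0 → I.vars π s ∉ B.C₂ :=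
    fun π s hπ hs h => (not_mem_C_of_qDir I hI hT hW hπ hs).2 h
  have hpol₂ : ∀ c d : Fin n, polarDir I B (1, 0) (Pi.single c 1) (Pi.single d 1) =
      ((polar B.T₂ (fun j => I.vars j 2) (fun j => I.vars j 3) + polar (freeMon I B.N B.G₂) (fun j => I.vars j 2) (fun j => I.vars j 3) :
        LinearMap.BilinForm (ZMod 2) (Fin n → ZMod 2)) (Pi.single c 1)) (Pi.single d 1) := fun c d => by
    rw [polarDir_single]; simp
  -- the unit's literals are off `π`
  have hoffν : ∀ s : Fin 4, (s = 2 ∨ s = 3) → ν₁ (Pi.single (I.vars π s) 1) = ν₁ 0 ∧ ν₂ (Pi.single (I.vars π s) 1) = ν₂ 0 := by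
    intro s hs
    obtain ⟨-, hc⟩ := privEdge_off_unit I hD heN hDe hπ hπD hs
    by_contra h
    rw [not_and_or] at h
    rcases (hsupp _).1 h with e1 | e1
    · exact hc (Or.inl hσ) e1
    · exact hc (Or.inr hτ) e1
  -- the second constraint's row `u_e + (q + (κ + γ_e)) = ν₁ν₂` does not read `π`
  have hrow₂ : ∀ x, (sys I B).u e x + (qDir I B (1, 0) x + (κ + gam B e)) = ν₁ x * ν₂ x := fun x => by
    rw [sys_u_eq, hEXC x]
    have e6 : ∀ g a p k : ZMod 2, g + (a + p + k) + (a + (k + g)) = p := by decide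
    exact e6 _ _ _ _
  obtain ⟨hC₂, hG₂⟩ := untouched_of_product_row I hI hS hD heN (mv := (1, 0)) hW.hT₂ hD.disj₂ hGf₂ hlin₂ hpol₂ hν₁ hν₂ (Or.inr hrow₂) hπ hoffν
  -- `q` is blind at the AND variables of `π`
  have hqlin : ∀ s : Fin 4, (s = 2 ∨ s = 3) → qDir I B (1, 0) (Pi.single (I.vars π s) 1) = qDir I B (1, 0) 0 := by
    intro s hs
    have h := qDir_single_add_zero I hI B (1, 0) (I.vars π s)
    have hC : I.vars π s ∉ B.C₂ := by rcases hs with rfl | rfl; exacts [hC₂.1, hC₂.2]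
    rw [if_neg (show ¬ (I.vars π s ∈ B.C₂ ∧ I.vars π s ∉ xverts I (B.J₀ \ B.N) ∧ I.vars π s ∉ privs I B.N) from fun h' => hC h'.1)] at h
    have h0 : qDir I B (1, 0) (Pi.single (I.vars π s) 1) + qDir I B (1, 0) 0 = 0 := by rw [h]; simp
    have e0 : ∀ a b : ZMod 2, a + b = 0 → a = b := by decide
    exact e0 _ _ h0
  have hqpol : ∀ s : Fin 4, (s = 2 ∨ s = 3) → ∀ w, polarDir I B (1, 0) (Pi.single w 1) (Pi.single (I.vars π s) 1) = 0 := by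
    intro s hs w
    obtain ⟨hvar, hc⟩ := privEdge_off_unit I hD heN hDe hπ hπD hs
    rw [hpol, if_neg, if_neg, add_zero]
    · rintro (⟨-, h⟩ | ⟨-, h⟩)
      · exact hc (Or.inr hτ) h
      · exact hc (Or.inl hσ) h
    · rintro ⟨j, hj, ⟨-, h⟩ | ⟨h, -⟩⟩
      · exact hvar j hj (h ▸ vars_mem_varSet I j 3)
      · exact hvar j hj (h ▸ vars_mem_varSet I j 2)
  have hshift : ∀ s : Fin 4, (s = 2 ∨ s = 3) → ∀ x, qDir I B (1, 0) (x + Pi.single (I.vars π s) 1) = qDir I B (1, 0) x := by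
    intro s hs x
    rw [qDir_add, apply_single_eq_zero (polarDir I B (1, 0)) (hqpol s hs) x, hqlin s hs]
    generalize qDir I B (1, 0) x = a; generalize qDir I B (1, 0) 0 = b; revert a b; decide
  -- the first constraint: `g := q₍₀,₁₎ + κ₁` vanishes on `Z(q)`
  set κ₁ : ZMod 2 := 1 + ∑ e' ∈ B.N.erase e_q, ((((sys I B).vsys e_p e_q).ρ e' 0).1 + (((sys I B).vsys e_p e_q).ρ' e' 0).1) with hκ₁
  have hconst := vsys_const I hD
  have hZ : ∀ x, qDir I B (1, 0) x = 0 → qDir I B (0, 1) x + κ₁ = 0 := fun x hx => by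
    rw [qDir01_of_q I hI hT hD hSR hx, hκ₁, sum_congr rfl fun e' _ => by rw [(hconst e' x 0).1, (hconst e' x 0).2]]
    exact CharTwo.add_self_eq_zero _
  have hqB := qDir_add I B (1, 0)
  have hrank := rank_four_of_unit_formula I (B := B) hI hDe hdisj hσ hτ hpol
  have hg : IsQuadFn fun x => qDir I B (0, 1) x + κ₁ := PstarCrossCaseU2.isQuadFn_qDir I B (0, 1) κ₁
  -- what "blind at `π`" means for the first constraint, and how each row gives it
  have goal_of : (∀ s : Fin 4, (s = 2 ∨ s = 3) → qDir I B (0, 1) (Pi.single (I.vars π s) 1) = qDir I B (0, 1) 0 ∧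
        ∀ w, polarDir I B (0, 1) (Pi.single w 1) (Pi.single (I.vars π s) 1) = 0) → False := by
    intro h
    have hC₁ : I.vars π 2 ∉ B.C₁ ∧ I.vars π 3 ∉ B.C₁ :=
      ⟨(not_mem_C_of_qDir I hI hT hW hπ.1 (s := 2) (by decide)).1 (h 2 (Or.inl rfl)).1,
       (not_mem_C_of_qDir I hI hT hW hπ.1 (s := 3) (by decide)).1 (h 3 (Or.inr rfl)).1⟩
    have hG₁ : ∀ g ∈ B.G₁, I.vars g 2 ≠ I.vars π 2 ∧ I.vars g 3 ≠ I.vars π 2 ∧ I.vars g 2 ≠ I.vars π 3 ∧ I.vars g 3 ≠ I.vars π 3 := by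
      intro g hg
      have hgf : g ∈ freeMon I B.N B.G₁ := mem_filter.2 ⟨hg, hGf₁ g hg⟩
      have h2 := (freeMon_avoid_of_polarDir_zero I hI hS hW hd₁ hD.disj₂).1 (h 2 (Or.inl rfl)).2 g hgf
      have h3 := (freeMon_avoid_of_polarDir_zero I hI hS hW hd₁ hD.disj₂).1 (h 3 (Or.inr rfl)).2 g hgf
      exact ⟨h2.1, h2.2, h3.1, h3.2⟩
    exact cross_touch I hI hD hπ.1 hπ.2 hC₁ hC₂ hG₁ hG₂
  -- polar form of `g` is `polarDir (0,1)`
  have hgB : ∀ x w, qDir I B (0, 1) (x + w) + κ₁ = qDir I B (0, 1) x + κ₁ + (qDir I B (0, 1) w + κ₁) + (qDir I B (0, 1) 0 + κ₁) + polarDir I B (0, 1) x w := by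
    intro x w; rw [qDir_add I B (0, 1) x w]
    generalize qDir I B (0, 1) x = a; generalize qDir I B (0, 1) w = b; generalize qDir I B (0, 1) 0 = c; generalize polarDir I B (0, 1) x w = d
    generalize κ₁ = k; revert a b c d k; decide
  -- row (A): `g ≡ 0`;  row (B): `g ≡ q`
  have rowA : (∀ x, qDir I B (0, 1) x + κ₁ = 0) → False := fun h0 => goal_of fun s hs => by
    have hc : ∀ x, qDir I B (0, 1) x = κ₁ := fun x => by
      have e1 : ∀ a k : ZMod 2, a + k = 0 → a = k := by decide
      exact e1 _ _ (h0 x)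
    refine ⟨by rw [hc, hc], fun w => ?_⟩
    have e := qDir_add I B (0, 1) (Pi.single w 1) (Pi.single (I.vars π s) 1)
    rw [hc, hc, hc, hc] at e
    have e2 : ∀ k d : ZMod 2, k = k + k + k + d → d = 0 := by decide
    exact e2 _ _ e
  have rowB : (∀ x, qDir I B (0, 1) x + κ₁ = qDir I B (1, 0) x) → False := fun hq => goal_of fun s hs => by
    have hpe : polarDir I B (0, 1) = polarDir I B (1, 0) := by
      refine polar_unique (Q := fun x => qDir I B (0, 1) x + κ₁) hgB fun x w => ?_
      show qDir I B (0, 1) (x + w) + κ₁ = _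
      rw [hq, hq, hq, hq]; exact hqB x w
    refine ⟨?_, fun w => by rw [hpe]; exact hqpol s hs w⟩
    have a := hq (Pi.single (I.vars π s) 1)
    have b := hq 0
    rw [hqlin s hs] at a
    have e3 : ∀ p q0 k c : ZMod 2, p + k = c → q0 + k = c → p = q0 := by decide
    exact e3 _ _ _ _ a b
  rcases classification hqB (exists_ne_of_rank_four hqB hrank) hg hZ with (h0 | hq) | ⟨μ₁, μ₂, h₁, h₂, hrow⟩ | ⟨a, b, -, hnor, -⟩
  · exact rowA h0
  · exact rowB hq
  · -- product rows: the product vanishes on `Z(q)`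
    have hPZ : ∀ x, qDir I B (1, 0) x = 0 → μ₁ x * μ₂ x = 0 := fun x hx => by
      rcases hrow with h | h
      · rw [← h x]; exact hZ x hx
      · rw [← h x, hZ x hx, hx, add_zero]
    by_cases hdeg : (∀ z, μ₁ z = μ₁ 0) ∨ (∀ z, μ₂ z = μ₂ 0) ∨ (∀ z, μ₁ z + μ₁ 0 = μ₂ z + μ₂ 0)
    · -- degenerate: the product is `0`, back to rows (A)/(B)
      have hP0 := affine_eq_zero_of_vanish hqB hrank (isAffineFn_mul_of_degenerate h₁ h₂ hdeg) hPZ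
      rcases hrow with h | h
      · exact rowA fun x => by rw [h x]; exact hP0 x
      · refine rowB fun x => ?_
        have e4 : ∀ q g : ZMod 2, q + g = 0 → g = q := by decide
        exact e4 _ _ (by rw [h x]; exact hP0 x)
    · push Not at hdeg
      obtain ⟨hn₁, hn₂, hn⟩ := hdeg
      refine goal_of fun s hs => ?_
      obtain ⟨hμ₁, hμ₂⟩ := shift_of_vanish hqB hrank h₁ h₂ hn₁ hn₂ hn hPZ (hshift s hs)
      -- polar form of `g`: `symForm` (+ `polarDir (1,0)`)
      have hsym0 : ∀ w, symForm (linPart h₁) (linPart h₂) (Pi.single w 1) (Pi.single (I.vars π s) 1) = 0 := fun w => by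
        rw [symForm_apply, linPart_apply, linPart_apply, linPart_apply, linPart_apply, hμ₁, hμ₂, CharTwo.add_self_eq_zero,
          CharTwo.add_self_eq_zero, mul_zero, zero_mul, add_zero]
      have hP1 : μ₁ (Pi.single (I.vars π s) 1) * μ₂ (Pi.single (I.vars π s) 1) = μ₁ 0 * μ₂ 0 := by rw [hμ₁, hμ₂]
      rcases hrow with h | h
      · have hpe : polarDir I B (0, 1) = symForm (linPart h₁) (linPart h₂) := by
          refine polar_unique (Q := fun x => qDir I B (0, 1) x + κ₁) hgB fun x w => ?_
          show qDir I B (0, 1) (x + w) + κ₁ = _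
          rw [h, h, h, h]; exact affine_mul_polar h₁ h₂ x w
        refine ⟨?_, fun w => by rw [hpe]; exact hsym0 w⟩
        have a := h (Pi.single (I.vars π s) 1)
        have b := h 0
        rw [hP1] at a
        have e3 : ∀ p q0 k c : ZMod 2, p + k = c → q0 + k = c → p = q0 := by decide
        exact e3 _ _ _ _ a b
      · have hpe : polarDir I B (0, 1) = polarDir I B (1, 0) + symForm (linPart h₁) (linPart h₂) := by
          refine polar_unique (Q := fun x => qDir I B (0, 1) x + κ₁) hgB fun x w => ?_
          show qDir I B (0, 1) (x + w) + κ₁ = _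
          have hg' : ∀ z, qDir I B (0, 1) z + κ₁ = qDir I B (1, 0) z + μ₁ z * μ₂ z := fun z => by
            have e5 : ∀ q g p : ZMod 2, q + g = p → g = q + p := by decide
            exact e5 _ _ _ (h z)
          rw [hg', hg', hg', hg', LinearMap.add_apply, LinearMap.add_apply, hqB x w, affine_mul_polar h₁ h₂ x w]
          generalize qDir I B (1, 0) x = a1; generalize qDir I B (1, 0) w = a2; generalize qDir I B (1, 0) 0 = a3
          generalize μ₁ x * μ₂ x = b1; generalize μ₁ w * μ₂ w = b2; generalize μ₁ 0 * μ₂ 0 = b3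
          generalize polarDir I B (1, 0) x w = c1; generalize symForm (linPart h₁) (linPart h₂) x w = c2
          revert a1 a2 a3 b1 b2 b3 c1 c2; decide
        refine ⟨?_, fun w => by rw [hpe, LinearMap.add_apply, LinearMap.add_apply, hqpol s hs w, hsym0 w, add_zero]⟩
        have a := h (Pi.single (I.vars π s) 1)
        have b := h 0
        rw [hP1, hqlin s hs] at a
        have e3 : ∀ q p q0 k c : ZMod 2, q + (p + k) = c → q + (q0 + k) = c → p = q0 := by decide
        exact e3 _ _ _ _ _ a b
  · -- NOR form of `q`: impossible next to a unit
    exact false_of_nor_of_excUnit I hI hDe hdisj hσ hτ hpol (ζ := 1) hnor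

end

end Summit.PneNP.PneNP.Theorems.PstarCrossCasePUnitBlind
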